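import Mathlib
import HarnessLib
import Summits.Ventures.LatticeQCDFlow.Scaling.HypercontractiveESSFloor

/-!
# HypercontractiveESSFloorExact — the ESS floor of the hypercontractive route with the PERFECT
# PART KEPT EXACT, `ÊSS ≥ exp(−Σ_k Λ_{k/n,1/n}(2)) · exp(−n·s·a/(1−θ))`, and the certified `n_step`
# rule `((1+θ)/(1−θ))·σ̄² ≤ η·n ⇒ ÊSS ≥ e^{−η}`

HONEST FRAMING: exact (Metropolis-corrected) sampling algorithms for lattice gauge theory;
figures of merit are autocorrelation/cost numbers at stated couplings and volumes; no
continuum-physics claim.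

Venture `LatticeQCDFlow` (cell pub-lqcd), topic `Scaling`; FANOUT row 19 (`su2-snf`, GEN-10).
OUR WORK, nothing cited as a fact.  Setting and vocabulary of `Scaling/HypercontractiveESSFloor`
(uniform grid, positive unit-row-sum layers leaving `π_{(k+1)/n}` invariant with
`HyperContracts (P k) π_{(k+1)/n} ρ`, `Var_c(D) ≤ σ̄²` for all `c`, `ε = σ̄²/n²`).

* **`exp_le_ess_path_uniform_hc_exact`** — `exp(−(Σ_{k<n}Λ_{k/n,1/n}(2) + n·s·a/(1−θ))) ≤ ÊSS`
  with `s = √(e^{4ε}−1)`, `a = ρ√(e^{ε}−1)`, `θ = ρe^{11ε/4} < 1`: the perfect-relaxation ESS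
  (`Scaling/PerfectRelaxationMoments.essFrac_path_perfect_eq`: `ÊSS_perfect = exp(−Σ_kΛ_k(2))`)
  times the certified lag factor — the form to quote when the variance profile of the switch
  observable varies along the path (reading rule P25), since `Σ_kΛ_k(2)` is computable from the
  equilibrium free-energy curve;
* **`ess_ge_exp_neg_of_steps_hc`** — THE `n_step` RULE: if `((1+θ)/(1−θ))·σ̄² ≤ η·n` then
  `ÊSS ≥ e^{−η}` (`η = 1`: the `1/e` rule of `Scaling/NonEquilibriumOverhead` is met by
  `n_step ≥ 2τ̄σ̄²`, `2τ̄ = (1+θ)/(1−θ)`).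

NOT CLAIMED: any value of `ρ`; non-uniform grids.
-/

namespace Summit.Ventures.LatticeQCDFlow.Scaling

open Finset
open Literature.Probability.MarkovChains (stepLaw IsStationary)
open Summit.Ventures.LatticeQCDFlow.Exactness
open Summit.Ventures.LatticeQCDFlow.Theory2

variable {X : Type*} [Fintype X] [Nonempty X]

/-- **THE ESS FLOOR WITH THE EXACT PERFECT PART (hypercontractive layers, uniform grid).**
With `ε = σ̄²/n²`, `s = √(e^{4ε}−1)`, `a = ρ√(e^{ε}−1)`, `θ = ρe^{11ε/4} < 1`:
`exp(−(Σ_{k<n} Λ_{k/n,1/n}(2) + n·s·a/(1−θ))) ≤ ÊSS`. -/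
theorem exp_le_ess_path_uniform_hc_exact (S₀ D : X → ℝ) (P : ℕ → X → X → ℝ) {n : ℕ} (hn : n ≠ 0)
    {ρ σbar : ℝ} (hPpos : ∀ k x y, 0 < P k x y) (hProw : ∀ k x, ∑ y, P k x y = 1)
    (hst : ∀ k, IsStationary (gibbsLaw (linAction S₀ D (((k + 1 : ℕ) : ℝ) / n))) (P k))
    (hK : ∀ k, HyperContracts (P k) (gibbsLaw (linAction S₀ D (((k + 1 : ℕ) : ℝ) / n))) ρ)
    (hρ : 0 ≤ ρ) (hσ : ∀ c, varD S₀ D c ≤ σbar ^ 2)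
    (hθ1 : ρ * Real.exp (11 * (σbar ^ 2 / n ^ 2) / 4) < 1) :
    Real.exp (-(∑ k ∈ Finset.range n,
            stepLogMGF S₀ D ((k : ℝ) / n) (((k + 1 : ℕ) : ℝ) / n - (k : ℝ) / n) 2
        + n * (Real.sqrt (Real.exp (2 ^ 2 * (σbar ^ 2 / n ^ 2)) - 1)
              * (ρ * Real.sqrt (Real.exp ((2 - 1) ^ 2 * (σbar ^ 2 / n ^ 2)) - 1))
              / (1 - ρ * Real.exp (11 * (σbar ^ 2 / n ^ 2) / 4)))))
      ≤ essFrac (revPathLaw (fun k : Fin (n + 1) => linAction S₀ D ((k : ℝ) / n))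
            (fun k : Fin n => P k))
          (pathLaw (gibbsLaw (linAction S₀ D (((0 : Fin (n + 1)) : ℝ) / n))) (fun k : Fin n => P k)) := by
  have hn' : (0 : ℝ) < n := Nat.cast_pos.mpr (Nat.pos_of_ne_zero hn)
  have h11 : (6 * (2:ℝ) ^ 2 - 8 * 2 + 3) * (σbar ^ 2 / n ^ 2) / 4 = 11 * (σbar ^ 2 / n ^ 2) / 4 := by
    ring
  have hθ1' : ρ * Real.exp ((6 * (2:ℝ) ^ 2 - 8 * 2 + 3) * (σbar ^ 2 / n ^ 2) / 4) < 1 := by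
    rwa [h11]
  have hmgf := expMoment_work_uniform_le_hc_exact 2 S₀ D P hn hPpos hProw hst hK hρ hσ hθ1'
  rw [h11, ← Real.exp_add] at hmgf
  -- the path-space identity 1/ÊSS = E_F[e^{-2(W-ΔF)}]
  set S : Fin (n + 1) → X → ℝ := fun k => linAction S₀ D ((k : ℝ) / n) with hS
  have hP' : ∀ (k : Fin n) x y, 0 < (fun k : Fin n => P k) k x y := fun k x y => hPpos k x y
  have hst' : ∀ k : Fin n, IsStationary (fun x => Real.exp (-(S k.succ x)))
      ((fun k : Fin n => P k) k) := by
    intro k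
    have h := isStationary_exp_neg_of_gibbsLaw (hst k)
    simpa only [hS, Fin.val_succ] using h
  have hid := inv_essFrac_path_eq_sum_exp_two S hP' hst'
  have hSlast : freeEnergy (S (Fin.last n)) = linFreeEnergy S₀ D 1 := by
    rw [hS, linFreeEnergy]; simp only [Fin.val_last]; rw [div_self hn'.ne']
  have hS0' : freeEnergy (S 0) = linFreeEnergy S₀ D 0 := by rw [hS, linFreeEnergy]; simp
  have hS0'' : gibbsLaw (S 0) = gibbsLaw (linAction S₀ D (((0 : ℕ) : ℝ) / n)) := by
    rw [hS]; simp
  rw [hSlast, hS0', hS0''] at hid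
  rw [← hid] at hmgf
  have hE0 : 0 < essFrac (revPathLaw S (fun k : Fin n => P k))
      (pathLaw (gibbsLaw (S 0)) (fun k : Fin n => P k)) :=
    essFrac_pos (pathLaw_pos (gibbsLaw_pos _) hP') (sum_revPathLaw _ _ hst')
  rw [Real.exp_neg, inv_le_comm₀ (Real.exp_pos _) hE0]
  exact hmgf

/-- **THE CERTIFIED `n_step` RULE.**  With `θ = ρe^{11σ̄²/(4n²)} < 1`: if
`((1+θ)/(1−θ))·σ̄² ≤ η·n` then `ÊSS ≥ e^{−η}` (`η = 1` is the `1/e` rule). -/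
theorem ess_ge_exp_neg_of_steps_hc (S₀ D : X → ℝ) (P : ℕ → X → X → ℝ) {n : ℕ} (hn : n ≠ 0)
    {ρ σbar η : ℝ} (hPpos : ∀ k x y, 0 < P k x y) (hProw : ∀ k x, ∑ y, P k x y = 1)
    (hst : ∀ k, IsStationary (gibbsLaw (linAction S₀ D (((k + 1 : ℕ) : ℝ) / n))) (P k))
    (hK : ∀ k, HyperContracts (P k) (gibbsLaw (linAction S₀ D (((k + 1 : ℕ) : ℝ) / n))) ρ)
    (hρ : 0 ≤ ρ) (hσ : ∀ c, varD S₀ D c ≤ σbar ^ 2)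
    (hθ1 : ρ * Real.exp (11 * (σbar ^ 2 / n ^ 2) / 4) < 1)
    (hsteps : (1 + ρ * Real.exp (11 * (σbar ^ 2 / n ^ 2) / 4))
        / (1 - ρ * Real.exp (11 * (σbar ^ 2 / n ^ 2) / 4)) * σbar ^ 2 ≤ η * n) :
    Real.exp (-η)
      ≤ essFrac (revPathLaw (fun k : Fin (n + 1) => linAction S₀ D ((k : ℝ) / n))
            (fun k : Fin n => P k))
          (pathLaw (gibbsLaw (linAction S₀ D (((0 : Fin (n + 1)) : ℝ) / n))) (fun k : Fin n => P k)) := by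
  have hn' : (0 : ℝ) < n := Nat.cast_pos.mpr (Nat.pos_of_ne_zero hn)
  have hfloor := exp_le_ess_path_uniform_hc S₀ D P hn hPpos hProw hst hK hρ hσ hθ1
  refine (Real.exp_le_exp.mpr ?_).trans hfloor
  rw [neg_le_neg_iff]
  rw [show (1 + ρ * Real.exp (11 * (σbar ^ 2 / n ^ 2) / 4))
        / (1 - ρ * Real.exp (11 * (σbar ^ 2 / n ^ 2) / 4)) * (σbar ^ 2 / n)
      = (1 + ρ * Real.exp (11 * (σbar ^ 2 / n ^ 2) / 4))
        / (1 - ρ * Real.exp (11 * (σbar ^ 2 / n ^ 2) / 4)) * σbar ^ 2 / n by ring]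
  rw [div_le_iff₀ hn']
  exact hsteps

end Summit.Ventures.LatticeQCDFlow.Scaling
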